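import Mathlib
import Summits.CriticalPhenomena.PercolationContinuityZ3.Theorems.PercNearOneGluingNoHeavyLowerTailTNKernels
import Summits.CriticalPhenomena.PercolationContinuityZ3.Theorems.PercNearOneGluingNoHeavyLowerTailHurwitzPositivePairTN
import HarnessLib

/-!
# CONJECTURE R at the classical vertex: the operator Hurwitz matrix of `F(D)` is totally nonnegative

Support file for the Sahi / Conjecture-P programme of route `PercNearOneGluingNoHeavy`
(`--supports stmt-CriticalPhenomena-4575`, prover prim-l12-p5 gen 50; proof note
`prim-l12-p5/PROOF-DRIFTING-HURWITZ-g50.md` §4(d) and `PROOF-NEUTRAL-HURWITZ-g47.md` §2.6).  No definitions,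
no named facts, no sorries.

At the vertex `g ≡ 0` of the sub-neutral cube (all copies classical) the λ-free band matrix is `W = F(D)`
(`D(n,n-1) = n`) for a real-rooted polynomial `F` with `F(0) = 1`, and its commutator is `C = [S, F(D)] = F'(D)`
(`[S, D^j] = j D^{j-1}`).  Since `F(D)(n,l) = n^{(n-l)}·[X^{n-l}]F` and `F'(D)(n,l) = n^{(n-l)}·[X^{n-l}]F'`
(`n^{(j)}` the falling factorial), the operator Hurwitz matrix `R(F(D)) = interleave(F(D), F'(D))` is the classical
Hurwitz matrix `H(F, F')` of g48's `positivePair_hurwitz_tn` rescaled by the positive diagonals `n!` (rows) and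
`1/l!` (columns).  For `F = ∏_{σ≤k}(1 + b_σ X)` with `0 < b_0 < … < b_k` the pair `(F, F')` is a positive pair by
Rolle's theorem (`classicalPair_roots`, the `E′` half of g49's `neutralPair_roots`), hence:

**THEOREM (`classical_hurwitz_tn`).**  The kernel `t = 2n ↦ (l ↦ n^{(n-l)}[X^{n-l}]F)`,
`t = 2n+1 ↦ (l ↦ n^{(n-l)}[X^{n-l}]F')` is totally nonnegative — CONJECTURE R at the classical vertex, for
every number `k+1` of classical copies with distinct weights (the operator form of Dyachenko's theorem on
`H(F′, F)` quoted in g46 §5).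
-/

namespace Summit.CriticalPhenomena.PercolationContinuityZ3.Theorems

namespace ClassicalVertex

open Finset Polynomial FallingMesh

/-- **Rolle for a product of linear factors.**  For `0 < b_0 < … < b_k`, `F = ∏_{σ≤k}(1 + b_σX)` is
`lp·∏_{i≤k}(X - ρ_i)` with `ρ_i = -1/b_i` increasing and negative, and `F' = lq·∏_{j<k}(X - γ_j)` with
`lp, lq > 0` and `ρ_j < γ_j < ρ_{j+1}` — so `(F, F')` is a positive pair. -/
theorem classicalPair_roots (k : ℕ) (b : ℕ → ℝ) (hb0 : 0 < b 0) (hb : StrictMono b) :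
    ∃ (lp lq : ℝ) (ρ γ : ℕ → ℝ), 0 < lp ∧ 0 < lq ∧ ρ k < 0 ∧
      (∀ i, i < k → ρ i < γ i ∧ γ i < ρ (i + 1)) ∧
      (∏ σ ∈ range (k + 1), (1 + C (b σ) * X)) = C lp * ∏ i ∈ range (k + 1), (X - C (ρ i)) ∧
      derivative (∏ σ ∈ range (k + 1), (1 + C (b σ) * X)) = C lq * ∏ i ∈ range k, (X - C (γ i)) := by
  have hbpos : ∀ i, 0 < b i := fun i => lt_of_lt_of_le hb0 (hb.monotone (Nat.zero_le i))
  set ρ : ℕ → ℝ := fun i => -(b i)⁻¹ with hρ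
  have hρneg : ∀ i, ρ i < 0 := fun i => by simp only [hρ]; exact neg_neg_of_pos (inv_pos.2 (hbpos i))
  have hρmono : ∀ i j, i < j → ρ i < ρ j := by
    intro i j hij
    simp only [hρ]
    rw [neg_lt_neg_iff, inv_lt_inv₀ (hbpos j) (hbpos i)]
    exact hb hij
  have hρle : ∀ i j, i ≤ j → ρ i ≤ ρ j := by
    intro i j hij
    rcases Nat.lt_or_ge i j with h | h
    · exact (hρmono i j h).le
    · rw [show i = j by omega]
  set lE : ℝ := ∏ σ ∈ range (k + 1), b σ with hlE
  have hlEpos : 0 < lE := prod_pos fun σ _ => hbpos σ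
  obtain ⟨E, hE⟩ : ∃ E : ℝ[X], E = ∏ σ ∈ range (k + 1), (1 + C (b σ) * X) := ⟨_, rfl⟩
  have hEform : E = C lE * ∏ i ∈ range (k + 1), (X - C (ρ i)) := by
    rw [hE, hlE, map_prod C, ← prod_mul_distrib]
    refine prod_congr rfl fun σ _ => ?_
    simp only [hρ]
    rw [C_neg, sub_neg_eq_add, mul_add, ← C_mul, mul_inv_cancel₀ (ne_of_gt (hbpos σ)), C_1, add_comm]
  obtain ⟨hEnd, hElc⟩ := prodForm_natDegree lE (ne_of_gt hlEpos) ρ (k + 1)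
  rw [← hEform] at hEnd hElc
  have hEev : ∀ y, E.eval y = lE * ∏ i ∈ range (k + 1), (y - ρ i) := fun y => by rw [hEform, prodForm_eval]
  have hEroot : ∀ j, j < k + 1 → E.eval (ρ j) = 0 := fun j hj => by
    rw [hEev]; exact mul_eq_zero_of_right _ (prod_eq_zero (mem_range.2 hj) (sub_self _))
  -- E' (Rolle)
  set E' : ℝ[X] := derivative E with hE'
  have hexγ : ∀ j, j < k → ∃ x, ρ j < x ∧ x < ρ (j + 1) ∧ E'.eval x = 0 := by
    intro j hj
    obtain ⟨x, hx, hx0⟩ := exists_deriv_eq_zero (f := fun y => E.eval y) (hρmono j (j + 1) (by omega))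
      E.continuous.continuousOn (by rw [hEroot j (by omega), hEroot (j + 1) (by omega)])
    refine ⟨x, hx.1, hx.2, ?_⟩
    rw [hE', ← Polynomial.deriv]; exact hx0
  choose! γ hγ using hexγ
  have hγ1 : ∀ j, j < k → ρ j < γ j := fun j hj => (hγ j hj).1
  have hγ2 : ∀ j, j < k → γ j < ρ (j + 1) := fun j hj => (hγ j hj).2.1
  have hγ3 : ∀ j, j < k → E'.eval (γ j) = 0 := fun j hj => (hγ j hj).2.2
  have hγmono : ∀ i j, i < j → j < k → γ i < γ j := by
    intro i j hij hjk; linarith [hγ2 i (by omega), hγ1 j hjk, hρle (i + 1) j (by omega)]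
  have hγneg : ∀ j, j < k → γ j < 0 := fun j hj => lt_trans (hγ2 j hj) (hρneg _)
  have hE'le : E'.natDegree ≤ k := by
    have h := natDegree_derivative_le E
    rw [hEnd, Nat.add_sub_cancel] at h
    exact h
  have hE'deg : E'.degree ≤ (k : ℕ) := degree_le_of_natDegree_le hE'le
  have hE'form := eq_prod_of_roots k E' hE'deg γ hγmono hγ3 0 hγneg
  have hE'k : E'.coeff k = ((k : ℝ) + 1) * lE := by
    rw [hE', coeff_derivative, show E.coeff (k + 1) = lE by
      rw [← hElc, Polynomial.leadingCoeff, hEnd]]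
    ring
  obtain ⟨lq, hlq⟩ : ∃ lq : ℝ, lq = E'.eval 0 / ∏ j ∈ range k, (0 - γ j) := ⟨_, rfl⟩
  rw [← hlq] at hE'form
  have hlqeq : lq = ((k : ℝ) + 1) * lE := by
    have h1 : (C lq * ∏ j ∈ range k, (X - C (γ j))).coeff k = lq := by
      rcases eq_or_ne lq 0 with h0 | h0
      · rw [h0, C_0, zero_mul, coeff_zero]
      · obtain ⟨hnd, hlc⟩ := prodForm_natDegree lq h0 γ k
        rw [Polynomial.leadingCoeff, hnd] at hlc
        exact hlc
    rw [← hE'form, hE'k] at h1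
    exact h1.symm
  have hlqpos : 0 < lq := by rw [hlqeq]; positivity
  refine ⟨lE, lq, ρ, γ, hlEpos, hlqpos, hρneg k, fun i hi => ⟨hγ1 i hi, hγ2 i hi⟩, ?_, ?_⟩
  · rw [← hE, hEform]
  · rw [← hE, ← hE', hE'form]

/-- **CONJECTURE R at the classical vertex (all T′).**  For `F = ∏_{σ≤k}(1 + b_σ X)` with
`0 < b_0 < … < b_k`, the operator Hurwitz matrix of `W = F(D)` — the kernel `t = 2n ↦ (n^{(n-l)}·[X^{n-l}]F)_l`,
`t = 2n+1 ↦ (n^{(n-l)}·[X^{n-l}]F')_l` (= `interleave(F(D), [S,F(D)])`) — is totally nonnegative. -/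
theorem classical_hurwitz_tn (k : ℕ) (b : ℕ → ℝ) (hb0 : 0 < b 0) (hb : StrictMono b)
    {m : ℕ} (r s : Fin m → ℕ) (hr : StrictMono r) (hs : StrictMono s) :
    0 ≤ (Matrix.of fun i j =>
      if r i % 2 = 0 then
        (if s j ≤ r i / 2 then ((r i / 2).descFactorial (r i / 2 - s j) : ℝ) *
          (∏ σ ∈ range (k + 1), (1 + C (b σ) * X)).coeff (r i / 2 - s j) else 0)
      else
        (if s j ≤ r i / 2 then ((r i / 2).descFactorial (r i / 2 - s j) : ℝ) *
          (derivative (∏ σ ∈ range (k + 1), (1 + C (b σ) * X))).coeff (r i / 2 - s j) else 0)).det := by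
  obtain ⟨lp, lq, ρ, γ, hlp, hlq, hρk, hJ, hF, hF'⟩ := classicalPair_roots k b hb0 hb
  -- the classical Hurwitz kernel of the positive pair (F, F')
  set H : ℕ → ℕ → ℝ := fun t l =>
    if t % 2 = 0 then (if l ≤ t / 2 then (C lp * ∏ i ∈ range (k + 1), (X - C (ρ i))).coeff (t / 2 - l) else 0)
    else (if l ≤ t / 2 then (C lq * ∏ i ∈ range k, (X - C (γ i))).coeff (t / 2 - l) else 0) with hH
  have hHtn : ∀ (m : ℕ) (r s : Fin m → ℕ), StrictMono r → StrictMono s →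
      0 ≤ (Matrix.of fun i j => H (r i) (s j)).det := fun m r s hr hs =>
    DiffHurwitz.positivePair_hurwitz_tn k lp lq ρ γ hlp hlq hρk hJ r s hr hs
  -- descFactorial = n!/l!
  have hdf : ∀ n l : ℕ, l ≤ n → (n.descFactorial (n - l) : ℝ) = (n.factorial : ℝ) * ((l.factorial : ℝ)⁻¹) := by
    intro n l hl
    have h := Nat.factorial_mul_descFactorial (Nat.sub_le n l)
    rw [Nat.sub_sub_self hl] at h
    have hl0 : (l.factorial : ℝ) ≠ 0 := by exact_mod_cast l.factorial_ne_zero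
    have h' : (l.factorial : ℝ) * (n.descFactorial (n - l) : ℝ) = n.factorial := by exact_mod_cast h
    field_simp
    linarith [h']
  have heq : (Matrix.of fun i j =>
      if r i % 2 = 0 then
        (if s j ≤ r i / 2 then ((r i / 2).descFactorial (r i / 2 - s j) : ℝ) *
          (∏ σ ∈ range (k + 1), (1 + C (b σ) * X)).coeff (r i / 2 - s j) else 0)
      else
        (if s j ≤ r i / 2 then ((r i / 2).descFactorial (r i / 2 - s j) : ℝ) *
          (derivative (∏ σ ∈ range (k + 1), (1 + C (b σ) * X))).coeff (r i / 2 - s j) else 0)) =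
      Matrix.of fun i j => ((r i / 2).factorial : ℝ) * H (r i) (s j) * ((s j).factorial : ℝ)⁻¹ := by
    ext i j
    simp only [Matrix.of_apply, hH]
    rw [hF', hF]
    by_cases hpar : r i % 2 = 0
    · rw [if_pos hpar, if_pos hpar]
      by_cases hle : s j ≤ r i / 2
      · rw [if_pos hle, if_pos hle, hdf _ _ hle]; ring
      · rw [if_neg hle, if_neg hle]; ring
    · rw [if_neg hpar, if_neg hpar]
      by_cases hle : s j ≤ r i / 2
      · rw [if_pos hle, if_pos hle, hdf _ _ hle]; ring
      · rw [if_neg hle, if_neg hle]; ring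
  rw [heq, TNKernel.det_kernel_scale H (fun t => ((t / 2).factorial : ℝ)) (fun l => ((l.factorial : ℝ))⁻¹) r s]
  refine mul_nonneg (prod_nonneg fun i _ => by positivity)
    (mul_nonneg (prod_nonneg fun j _ => by positivity) (hHtn m r s hr hs))

end ClassicalVertex

end Summit.CriticalPhenomena.PercolationContinuityZ3.Theorems
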